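import Mathlib
import Summits.QuantumFields.BalabanUV.Beta.CovariantPlateauBlocks
import Summits.QuantumFields.BalabanUV.Beta.CoarseCoerciveBlock1D

/-!
# Beta / CovariantPlateauBlocksEnd — THE GENERAL-U MODEL INSTANCE OF E-I3, PART 2 (the END): ν-dimensional IN-BLOCK
# product plateaus × tree transports against the covariant Gram form `A_W = μ₀ + D_Wᴴ D_W` (covariant Laplacian + mass of
# the glued block lattice with ANY orthogonal bond transporters `W`) — by the owner's `coarse_coercive_cov` (p221805) BY
# NAME with the U = 1 counting (`S₁ = 1`, `S₂ = n^ν`, mass `((n − 2w)/n)^ν`, slopes `1/w`) and this unit's holonomy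
# input `h ≤ ν(n−1)·α` (p222441 ∕ p222209):
#   **((n−2w)/n)^{2ν} / (μ₀ n^ν + ν n^ν (1/w + ν(n−1)α)²) · ‖B‖² ≤ Re B*(Q̃_W A_W⁻¹ Q̃_Wᵀ) B  for EVERY transport field
#   whose in-block plaquettes are within α of 1** — at `W ≡ 1` (α = 0), ν = 1 exactly the owner's `CoarseCoerciveBlock1D`
#   constant; uniform in the block size `n` as soon as `ν(n−1)α ≲ 1/w` (print's O(1)Mα₀ bookkeeping: plaquette ~ α₀η²-size ×
#   contour length ~ L^j).  (unit `b2b-balaban-beta-d4-p2`, GEN 6, MODEL crew; claim «E-I3-COV-MODEL» journal l.15376)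

HONEST FRAMING: discharging `BetaPertH` makes Bałaban's UV stability UNCONDITIONAL — NOT the continuum limit, NOT the
Clay problem.  HONEST DEPENDENCY (verbatim): «continuum YM on T⁴ ⇐ BetaPertH ∧ nine spine estimates (0/9 proved);
BetaPertH ⇐ (D1) ∧ (D4) ∧ CAP+tail; G-an2-4 gates asym, D1 and NE2/3/4.»  THIS MODULE DISCHARGES NOTHING of `BetaPertH`,
asserts NOTHING printed and cites nothing as a fact (ABSOLUTE RULE): [folklore] counting about a MODEL (cubic blocks, any
gluing, in-block product plateaus, tree contours, orthogonal transporters as DATA); nothing of Bałaban's operators is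
instantiated (his `G₂`, `Δ″`, the a-terms, the averaged `Ū`, (3.35) itself are NODE O.2's ∕ NOTE-I3 (s)); constants are
NOT k-uniform statements about Bałaban's scheme.  SHAPES located at [B9] = `Balaban1985BackgroundPropagators` (3.19) p. 393,
(3.35) p. 396, (3.132) p. 422; [B6] = `Balaban1984PropagatorsII` (2.76) p. 236 («γ₀ absolute»).  No class change on row D4
or G-B9-15 (width 0; D4 DISCHARGE NO DATE); NOT BetaPertH, NOT continuum, NOT Clay, NOT summit progress.

CONTENT (kernel, 0 sorry).  §1 the product plateau `pP v = Π_i plateau(v i)` (owner's 1-D `plateau` p220436): `0 ≤ pP ≤ 1`,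
vanishing on the block boundary, slope `≤ 1/w` along in-block bonds, `Σ_v pP v = (Σ_j plateau j)^ν`.  §2 the covariant
data: profile `tB` (in-block), block-mean weights `sB`, disjointness, `S₁ = 1`, `S₂`, mass `δ = ((Σ plateau)/n)^ν ≥
((n−2w)/n)^ν`.  §3 the bond counting: **`kbound`** (`|Δ_b t_y| + |t_y(src b)|·h b y ≤ [src b ∈ B(y)]·(1/w + H)`, gluing
bonds carry NOTHING for any gluing and any transport), row sums `θ₁′ = 1/w + H`, column sums `θ₂′ = ν n^ν (1/w + H)`.
§4 END **`coarse_coercive_plateau_blocks`** (owner's `coarse_coercive_cov` BY NAME on `gramForm μ₀ (covDiff bsrc (btgt σ) W)`)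
with **`coarse_coercive_plateau_blocks_scaled`** (`4w ≤ n ≤ 8w`, `μ₀ = a/n²`, `ν(n−1)α ≤ 1/w` ⟹ constant ≥
`(1/4)^ν/(a + 256ν)·n²/n^ν`, uniform in `n` at the sharp scaling `n^{2−ν}`) and the flat corollary
**`coarse_coercive_plateau_blocks_flat`** (`W ≡ 1`: the ν-dim U = 1 in-block node the owner left to this seat, journal
l.14672).  §5 non-vacuity (explicit constant `1/54` checked by `norm_num`).  PRIOR ART (searched 2026-08-20, `lean search
'coarse_coercive|covFamily|plateau|tentT'`): owner's `CoarseCoerciveBlock1D` (ν = 1, U = 1), `CoarseCoerciveCovariantEnergy`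
(the abstract engine USED here), `CoarseCoerciveTransport` (mass side USED through the engine); this unit's gen-5
`TentQuasiReconstructionTorus` (U = 1, OVERLAPPING tensor tents on `(ℤ∕m × Fin n)^ν`); d4-p3's `UnitLatticeOmega*` box ENDs
(U = 1); T4 NE2's `VectorBlockTrialFormCovariant` (a trial-form object, no coarse coercivity).  No general-U instance existed.
-/

namespace Summit.QuantumFields.BalabanUV.Beta.CovariantPlateauBlocksEnd

open scoped BigOperators Matrix Matrix.Norms.L2Operator
open Finset
open Literature.MathematicalPhysics.QuantumFieldTheory.Balaban1983to89.B5Prop11Lower (nsq nsq_nonneg)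
open Summit.QuantumFields.BalabanUV.Beta.AccretiveCombesThomasSandwich (sandwich)
open Summit.QuantumFields.BalabanUV.Beta.CoarseCoerciveTransport (covFamily)
open Summit.QuantumFields.BalabanUV.Beta.CoarseCoerciveCovariantEnergy (covDiff coarse_coercive_cov)
open Summit.QuantumFields.BalabanUV.Beta.CoarseCoerciveBlock1D (gramForm gramForm_isHermitian isUnit_gramForm
  re_form_gramForm re_form_gramForm_nonneg plateau plateau_nonneg plateau_left plateau_right abs_plateau_sub_le
  sum_plateau_ge)
open Summit.QuantumFields.BalabanUV.Beta.ThinLoopHolonomy (cpxHom)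
open Summit.QuantumFields.BalabanUV.Beta.CovariantPlateauBlocks

noncomputable section

variable {Y : Type*} [Fintype Y] [DecidableEq Y] {Cp : Type*} [Fintype Cp] [DecidableEq Cp] {ν n w : ℕ}

/-! ## §1 The ν-dimensional product plateau -/

/-- **The product plateau** `Π_i plateau(v i)` on a block — IN-BLOCK (it vanishes on the block's boundary layer).
[cite: Balaban1984PropagatorsII, (2.76) p.236] -/
def pP (n w : ℕ) (v : Off ν n) : ℝ := ∏ i, plateau n w (v i)

/-- `plateau ≤ 1`. [folklore] -/
theorem plateau_le_one (i : Fin n) : plateau n w i ≤ 1 := min_le_left _ _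

/-- `pP ≥ 0`. [folklore] -/
theorem pP_nonneg (hw : 0 < w) (v : Off ν n) : 0 ≤ pP n w v := Finset.prod_nonneg fun i _ => plateau_nonneg hw (v i)

/-- `pP ≤ 1`. [folklore] -/
theorem pP_le_one (hw : 0 < w) (v : Off ν n) : pP n w v ≤ 1 :=
  Finset.prod_le_one (fun i _ => plateau_nonneg hw (v i)) fun i _ => plateau_le_one (v i)

/-- Splitting off one axis: `pP v = plateau(v i) · Π_{j ≠ i} plateau(v j)`. [folklore] -/
theorem pP_eq_mul_erase (v : Off ν n) (i : Fin ν) : pP n w v = plateau n w (v i) * ∏ j ∈ univ.erase i, plateau n w (v j) :=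
  (Finset.mul_prod_erase univ (fun j => plateau n w (v j)) (mem_univ i)).symm

/-- The same after an update in axis `i`. [folklore] -/
theorem pP_update (v : Off ν n) (i : Fin ν) (a : Fin n) :
    pP n w (Function.update v i a) = plateau n w a * ∏ j ∈ univ.erase i, plateau n w (v j) := by
  rw [pP_eq_mul_erase _ i, Function.update_self]
  congr 1
  exact Finset.prod_congr rfl fun j hj => by rw [Function.update_of_ne (ne_of_mem_erase hj)]

/-- The transverse factor lies in `[0, 1]`. [folklore] -/
theorem prod_erase_mem (hw : 0 < w) (v : Off ν n) (i : Fin ν) :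
    0 ≤ ∏ j ∈ univ.erase i, plateau n w (v j) ∧ ∏ j ∈ univ.erase i, plateau n w (v j) ≤ 1 :=
  ⟨Finset.prod_nonneg fun j _ => plateau_nonneg hw (v j),
    Finset.prod_le_one (fun j _ => plateau_nonneg hw (v j)) fun j _ => plateau_le_one (v j)⟩

/-- **SLOPE ALONG AN IN-BLOCK BOND**: `|pP(v + e_i) − pP(v)| ≤ 1/w`. [folklore] -/
theorem abs_pP_succ_sub_le (hw : 0 < w) (v : Off ν n) (i : Fin ν) (h : (v i : ℕ) + 1 < n) :
    |pP n w (succOff v i h) - pP n w v| ≤ 1 / w := by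
  rw [succOff, pP_update, pP_eq_mul_erase v i, ← sub_mul, abs_mul, abs_of_nonneg (prod_erase_mem hw v i).1]
  calc _ ≤ (1 : ℝ) / w * 1 := mul_le_mul (abs_plateau_sub_le hw (v i) ⟨v i + 1, h⟩ rfl) (prod_erase_mem hw v i).2
        (prod_erase_mem hw v i).1 (by positivity)
    _ = 1 / w := mul_one _

/-- The product plateau vanishes when some offset is `0` … [folklore] -/
theorem pP_eq_zero_of_left (hw : 0 < w) (v : Off ν n) (i : Fin ν) (h0 : (v i : ℕ) = 0) : pP n w v = 0 :=
  Finset.prod_eq_zero (mem_univ i) (plateau_left hw (v i) h0)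

/-- … or `n − 1` (the block's boundary layer). [folklore] -/
theorem pP_eq_zero_of_right (hw : 0 < w) (v : Off ν n) (i : Fin ν) (h : (v i : ℕ) + 1 = n) : pP n w v = 0 :=
  Finset.prod_eq_zero (mem_univ i) (plateau_right hw (v i) h)

/-- **`Σ_v pP v = (Σ_j plateau j)^ν`** (sum–product exchange). [folklore] -/
theorem sum_pP : ∑ v : Off ν n, pP n w v = (∑ j : Fin n, plateau n w j) ^ ν := by
  unfold pP
  rw [← Fintype.piFinset_univ, ← Finset.prod_univ_sum (fun _ : Fin ν => (univ : Finset (Fin n))) fun _ j => plateau n w j,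
    Finset.prod_const, card_univ, Fintype.card_fin]

/-- `0 ≤ Σ_j plateau j ≤ n`. [folklore] -/
theorem sum_plateau_mem (hw : 0 < w) : 0 ≤ ∑ j : Fin n, plateau n w j ∧ ∑ j : Fin n, plateau n w j ≤ n :=
  ⟨Finset.sum_nonneg fun j _ => plateau_nonneg hw j,
    (Finset.sum_le_sum fun j _ => plateau_le_one j).trans (by simp)⟩

/-! ## §2 The covariant data on the block lattice: profile, block means, `S₁`, `S₂`, mass -/

variable [NeZero n]

/-- THE IN-BLOCK PROFILE `t_y(x) = [x ∈ B(y)]·pP(offset x)`. [cite: Balaban1984PropagatorsII, (2.76) p.236] -/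
def tB (w : ℕ) (y : Y) (x : BSite Y ν n) : ℝ := if x.1 = y then pP n w x.2 else 0

/-- THE BLOCK-MEAN WEIGHTS `s_y(x) = [x ∈ B(y)]·n^{−ν}` (the `L^{−jd}` of (3.19)). [cite: Balaban1985BackgroundPropagators, (3.19) p.393] -/
def sB (y : Y) (x : BSite Y ν n) : ℝ := if x.1 = y then (((n : ℝ) ^ ν)⁻¹) else 0

omit [Fintype Y] [NeZero n] in
/-- Disjoint block supports (the owner's `hdisj`). [folklore] -/
theorem tB_mul_sB_eq_zero (y y' : Y) (x : BSite Y ν n) (h : y ≠ y') : tB w y x * sB y' x = 0 := by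
  unfold tB sB
  by_cases hx : x.1 = y
  · rw [if_neg (fun h' => h (hx.symm.trans h')), mul_zero]
  · rw [if_neg hx, zero_mul]

omit [NeZero n] in
/-- **`S₁ = 1`**: at every site only its own block's profile is present, and it is `≤ 1`. [folklore] -/
theorem sum_abs_tB_site_le (hw : 0 < w) (x : BSite Y ν n) : ∑ y, |tB w y x| ≤ 1 := by
  unfold tB
  simp_rw [apply_ite (fun r : ℝ => |r|), abs_zero]
  rw [Finset.sum_ite_eq univ x.1, if_pos (mem_univ _), abs_of_nonneg (pP_nonneg hw _)]
  exact pP_le_one hw _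

omit [NeZero n] in
/-- `Σ_x t_y(x) = (Σ_j plateau j)^ν`. [folklore] -/
theorem sum_tB (y : Y) : ∑ x : BSite Y ν n, tB w y x = (∑ j : Fin n, plateau n w j) ^ ν := by
  unfold tB
  rw [Fintype.sum_prod_type]
  simp_rw [← sum_pP (ν := ν) (n := n) (w := w)]
  rw [Finset.sum_comm]
  refine Finset.sum_congr rfl fun v _ => ?_
  rw [Finset.sum_ite_eq' univ y, if_pos (mem_univ _)]

omit [NeZero n] in
/-- **`S₂ ≤ n^ν`**. [folklore] -/
theorem sum_abs_tB_block_le (hw : 0 < w) (y : Y) : ∑ x : BSite Y ν n, |tB w y x| ≤ (n : ℝ) ^ ν := by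
  have habs : ∀ x : BSite Y ν n, |tB w y x| = tB w y x := fun x => by
    unfold tB; split_ifs; exacts [abs_of_nonneg (pP_nonneg hw _), abs_zero]
  simp_rw [habs]
  rw [sum_tB]
  exact pow_le_pow_left₀ (sum_plateau_mem hw).1 (sum_plateau_mem hw).2 ν

/-- **THE MASS NUMBER**: `Σ_x t_y(x)s_y(x) = ((Σ_j plateau j)/n)^ν ≥ ((n − 2w)/n)^ν` (owner's `sum_plateau_ge`). [folklore] -/
theorem mass_ge (hw : 0 < w) (h2w : 2 * w ≤ n) (y : Y) :
    (((n : ℝ) - 2 * w) / n) ^ ν ≤ ∑ x : BSite Y ν n, tB w y x * sB y x := by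
  have hmul : ∀ x : BSite Y ν n, tB w y x * sB y x = tB w y x * ((n : ℝ) ^ ν)⁻¹ := fun x => by
    unfold tB sB; split_ifs <;> simp
  simp_rw [hmul]
  rw [← Finset.sum_mul, sum_tB, ← div_eq_mul_inv, ← div_pow]
  have hn : (0 : ℝ) < n := by exact_mod_cast Nat.pos_of_ne_zero (NeZero.ne n)
  have h0 : 0 ≤ ((n : ℝ) - 2 * w) / n := div_nonneg (by rw [sub_nonneg]; exact_mod_cast h2w) hn.le
  exact pow_le_pow_left₀ h0 (div_le_div_of_nonneg_right (sum_plateau_ge hw) hn.le) ν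

/-! ## §3 The bond counting: gluing bonds carry nothing; in-block bonds cost `1/w + H` -/

variable (W : Bond Y ν n → Matrix Cp Cp ℝ) (hW : ∀ b, (W b)ᵀ * W b = 1)

omit [Fintype Y] in
/-- **THE BOND MAJORANT**: with a bound `H ≥ 0` on the defect of in-block bonds,
`|t_y(tgt b) − t_y(src b)| + |t_y(src b)|·h b y ≤ [src b ∈ B(y)]·(1/w + H)` — a gluing bond has BOTH endpoints on block
boundaries where the profile vanishes (any gluing, any transport), an in-block bond pays the slope `1/w` and the defect
`H`. [folklore] -/
theorem kbound (σ : Fin ν → Y → Y) (hw : 0 < w) {H : ℝ} (hH0 : 0 ≤ H)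
    (hH : ∀ b : Bond Y ν n, (b.1.2 b.2 : ℕ) + 1 < n → ∀ y, hdef W hW σ b y ≤ H) (b : Bond Y ν n) (y : Y) :
    |tB w y (btgt σ b) - tB w y (bsrc b)| + |tB w y (bsrc b)| * hdef W hW σ b y ≤
      if b.1.1 = y then 1 / w + H else 0 := by
  have hw' : (0 : ℝ) ≤ 1 / w := by positivity
  by_cases hb : (b.1.2 b.2 : ℕ) + 1 < n
  · -- in-block bond
    rw [btgt_of_inBlk σ hb]
    unfold tB bsrc
    by_cases hy : b.1.1 = y
    · simp only [hy, if_true]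
      refine add_le_add (abs_pP_succ_sub_le hw _ _ hb) ?_
      rw [abs_of_nonneg (pP_nonneg hw _)]
      calc pP n w b.1.2 * hdef W hW σ b y ≤ 1 * H :=
            mul_le_mul (pP_le_one hw _) (hH b hb y) (hdef_nonneg W hW σ b y) zero_le_one
        _ = H := one_mul H
    · simp only [hy, if_false, sub_zero, abs_zero, zero_mul, add_zero, le_refl]
  · -- gluing bond: both endpoints on block boundaries
    have hvi : (b.1.2 b.2 : ℕ) + 1 = n := by have := (b.1.2 b.2).isLt; omega
    have hsrc : tB w y (bsrc b) = 0 := by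
      unfold tB bsrc; split_ifs
      · exact pP_eq_zero_of_right hw _ b.2 hvi
      · rfl
    have htgt : tB w y (btgt σ b) = 0 := by
      unfold tB btgt; rw [dif_neg hb]; split_ifs
      · exact pP_eq_zero_of_left hw _ b.2 (by simp)
      · rfl
    rw [hsrc, htgt, sub_zero, abs_zero, zero_mul, add_zero]
    split_ifs
    · positivity
    · exact le_rfl

/-- **ROW SUMS `θ₁′ = 1/w + H`**. [folklore] -/
theorem row_le (σ : Fin ν → Y → Y) (hw : 0 < w) {H : ℝ} (hH0 : 0 ≤ H)
    (hH : ∀ b : Bond Y ν n, (b.1.2 b.2 : ℕ) + 1 < n → ∀ y, hdef W hW σ b y ≤ H) (b : Bond Y ν n) :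
    ∑ y, (|tB w y (btgt σ b) - tB w y (bsrc b)| + |tB w y (bsrc b)| * hdef W hW σ b y) ≤ 1 / w + H := by
  refine (Finset.sum_le_sum fun y _ => kbound W hW σ hw hH0 hH b y).trans ?_
  rw [Finset.sum_ite_eq univ b.1.1, if_pos (mem_univ _)]

omit [NeZero n] in
/-- The number of bonds issuing from a block: `Σ_b [src b ∈ B(y)]·c = ν·n^ν·c`. [folklore] -/
theorem sum_ite_block (y : Y) (c : ℝ) : ∑ b : Bond Y ν n, (if b.1.1 = y then c else 0) = ν * (n : ℝ) ^ ν * c := by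
  calc ∑ b : Bond Y ν n, (if b.1.1 = y then c else 0)
      = ∑ x : BSite Y ν n, ∑ _i : Fin ν, (if x.1 = y then c else 0) := by rw [Fintype.sum_prod_type]
    _ = ∑ x : BSite Y ν n, (ν : ℝ) * (if x.1 = y then c else 0) := by
        refine Finset.sum_congr rfl fun x _ => ?_
        rw [Finset.sum_const, Finset.card_univ, Fintype.card_fin, nsmul_eq_mul]
    _ = ∑ y' : Y, ∑ _v : Off ν n, (ν : ℝ) * (if y' = y then c else 0) := by rw [Fintype.sum_prod_type]
    _ = ∑ y' : Y, ((n : ℝ) ^ ν * ν) * (if y' = y then c else 0) := by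
        refine Finset.sum_congr rfl fun y' _ => ?_
        rw [Finset.sum_const, Finset.card_univ, Fintype.card_fun, Fintype.card_fin, Fintype.card_fin, nsmul_eq_mul]
        push_cast
        ring
    _ = ν * (n : ℝ) ^ ν * c := by
        rw [← Finset.mul_sum, Finset.sum_ite_eq' univ y, if_pos (mem_univ _)]
        ring

/-- **COLUMN SUMS `θ₂′ = ν n^ν (1/w + H)`**. [folklore] -/
theorem col_le (σ : Fin ν → Y → Y) (hw : 0 < w) {H : ℝ} (hH0 : 0 ≤ H)
    (hH : ∀ b : Bond Y ν n, (b.1.2 b.2 : ℕ) + 1 < n → ∀ y, hdef W hW σ b y ≤ H) (y : Y) :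
    ∑ b : Bond Y ν n, (|tB w y (btgt σ b) - tB w y (bsrc b)| + |tB w y (bsrc b)| * hdef W hW σ b y) ≤
      ν * (n : ℝ) ^ ν * (1 / w + H) := by
  refine (Finset.sum_le_sum fun b _ => kbound W hW σ hw hH0 hH b y).trans ?_
  rw [sum_ite_block]

/-! ## §4 THE END: coarse coercivity of `Q̃_W A_W⁻¹ Q̃_Wᵀ` for every transport field -/

/-- **E-I3 FOR A GENERAL BACKGROUND, MODEL INSTANCE.**  Blocks `Y` of side `n` in `ν` dimensions with ANY gluing `σ`,
fibre `Cp`, ANY orthogonal bond transporters `W`; fine operator `A_W = μ₀·1 + D_Wᴴ D_W` (covariant Laplacian + mass);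
`Q̃_W` = the covariant block means with the tree transports; assume every in-block plaquette of `W` is within `α` of `1`
(ℓ²-operator norm of the complexification).  Then for every coarse `B`, with `H = ν(n−1)·α`,
`(((n−2w)/n)^ν)² / (μ₀·n^ν + (1/w + H)·(ν n^ν (1/w + H))) · ‖B‖² ≤ Re B*(Q̃_W A_W⁻¹ Q̃_Wᵀ)B` — the owner's
`coarse_coercive_cov` with `S₁ = 1`, `S₂ = n^ν`, `δ = ((n−2w)/n)^ν`, `θ′ = (1/w + H, ν n^ν(1/w + H))`, `h = hdef`.
[cite: Balaban1985BackgroundPropagators, (3.19) p.393, (3.35) p.396] -/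
theorem coarse_coercive_plateau_blocks [Nonempty Cp] (σ : Fin ν → Y → Y) (hw : 0 < w) (h2w : 2 * w < n) {μ0 : ℝ}
    (hμ0 : 0 < μ0) {α : ℝ} (hα : 0 ≤ α)
    (hplaqW : ∀ (y : Y) (v : Off ν n) (κ μ : Fin ν) (hκ : (v κ : ℕ) + 1 < n) (hμ : (v μ : ℕ) + 1 < n), κ ≠ μ →
      ‖cpxHom (plaqW W y v κ μ hκ hμ) - 1‖ ≤ α) (B : Y × Cp → ℂ) :
    ((((n : ℝ) - 2 * w) / n) ^ ν) ^ 2 /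
        (μ0 * (1 * (n : ℝ) ^ ν) + (1 / w + ν * ((n : ℝ) - 1) * α) * (ν * (n : ℝ) ^ ν * (1 / w + ν * ((n : ℝ) - 1) * α))) *
      nsq B ≤ (star B ⬝ᵥ (sandwich (gramForm μ0 (covDiff bsrc (btgt σ) W)) (covFamily sB (Rfam W hW)) *ᵥ B)).re := by
  have hn : (0 : ℝ) < n := by exact_mod_cast Nat.pos_of_ne_zero (NeZero.ne n)
  have hH0 : 0 ≤ ν * ((n : ℝ) - 1) * α := by
    have : (1 : ℝ) ≤ n := by exact_mod_cast Nat.pos_of_ne_zero (NeZero.ne n)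
    have : 0 ≤ (n : ℝ) - 1 := by linarith
    positivity
  have hH := fun (b : Bond Y ν n) (hb : (b.1.2 b.2 : ℕ) + 1 < n) (y : Y) => hdef_le_of_plaqW W hW σ hα hplaqW hb y
  have hδ0 : 0 < (((n : ℝ) - 2 * w) / n) ^ ν := by
    have : (0 : ℝ) < (n : ℝ) - 2 * w := by
      have : (2 * w : ℝ) < n := by exact_mod_cast h2w
      linarith
    positivity
  have hθ0 : (0 : ℝ) ≤ 1 / w + ν * ((n : ℝ) - 1) * α := by positivity
  have hE : 0 < μ0 * (1 * (n : ℝ) ^ ν) +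
      (1 / w + ν * ((n : ℝ) - 1) * α) * (ν * (n : ℝ) ^ ν * (1 / w + ν * ((n : ℝ) - 1) * α)) := by positivity
  exact coarse_coercive_cov (gramForm μ0 (covDiff bsrc (btgt σ) W)) (gramForm_isHermitian _ _) (isUnit_gramForm hμ0 _)
    (re_form_gramForm_nonneg hμ0.le _) bsrc (btgt σ) W hμ0.le (fun z => (re_form_gramForm μ0 _ z).le) (tB w) sB
    (fun y y' x h => tB_mul_sB_eq_zero y y' x h) (Rfam W hW) (fun _ x => Rtr_mul_transpose W hW x) hW hδ0
    (mass_ge hw h2w.le) (hdef W hW σ) (hdef_nonneg W hW σ) (hhol_hdef W hW σ) zero_le_one (sum_abs_tB_site_le hw)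
    (sum_abs_tB_block_le hw) hθ0 (row_le W hW σ hw hH0 hH) (col_le W hW σ hw hH0 hH) hE B

omit [Fintype Y] [DecidableEq Y] [NeZero n] in
/-- The flat transport `W ≡ 1` is orthogonal. [folklore] -/
theorem flat_orth : ∀ b : Bond Y ν n, ((fun _ => (1 : Matrix Cp Cp ℝ)) b)ᵀ * (fun _ => (1 : Matrix Cp Cp ℝ)) b = 1 :=
  fun _ => by simp

/-- **THE ν-DIMENSIONAL U = 1 IN-BLOCK NODE** (owner's C-an4-107 design, left to this seat journal l.14672): at the flat
transport every plaquette equals `1`, so `α = 0` and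
`(((n−2w)/n)^ν)² / (μ₀ n^ν + (1/w)·(ν n^ν/w)) · ‖B‖² ≤ Re B*(Q̃ A⁻¹ Q̃ᵀ)B` — at ν = 1 the owner's `CoarseCoerciveBlock1D`
constant `(1 − 2w/n)²/(μ₀n + n/w²)`. [cite: Balaban1984PropagatorsII, (2.76) p.236] -/
theorem coarse_coercive_plateau_blocks_flat [Nonempty Cp] (σ : Fin ν → Y → Y) (hw : 0 < w) (h2w : 2 * w < n) {μ0 : ℝ}
    (hμ0 : 0 < μ0) (B : Y × Cp → ℂ) :
    ((((n : ℝ) - 2 * w) / n) ^ ν) ^ 2 / (μ0 * (1 * (n : ℝ) ^ ν) + (1 / w + ν * ((n : ℝ) - 1) * 0) *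
        (ν * (n : ℝ) ^ ν * (1 / w + ν * ((n : ℝ) - 1) * 0))) * nsq B ≤
      (star B ⬝ᵥ (sandwich (gramForm μ0 (covDiff bsrc (btgt σ) fun _ : Bond Y ν n => (1 : Matrix Cp Cp ℝ)))
        (covFamily (sB (Y := Y) (ν := ν) (n := n)) (Rfam (fun _ : Bond Y ν n => (1 : Matrix Cp Cp ℝ)) flat_orth)) *ᵥ
          B)).re :=
  coarse_coercive_plateau_blocks _ flat_orth σ hw h2w hμ0 le_rfl (fun y v κ μ hκ hμ _ => by simp [plaqW]) B

/-- **UNIFORMITY IN THE BLOCK SIZE** (the «γ₀ absolute» reading for a general background): with `4w ≤ n ≤ 8w`, fine mass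
`μ₀ = a/n²` (`a > 0`) and the holonomy smallness `ν(n−1)·α ≤ 1/w` (print's bookkeeping: plaquette defect × contour length
= O(1)Mα₀ ≲ the slope), the coercivity constant is at least `(1/4)^ν/(a + 256ν) · n²/n^ν` — the sharp lattice-unit scaling
`n^{2−ν}` (constant coarse vectors give `n^{2−ν}/a` exactly) with a factor seeing `ν` and `a` only, for EVERY transport
field in the class. [cite: Balaban1984PropagatorsII, (2.76) p.236] -/
theorem coarse_coercive_plateau_blocks_scaled [Nonempty Cp] (σ : Fin ν → Y → Y) (hw : 0 < w) (h4 : 4 * w ≤ n)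
    (h8 : n ≤ 8 * w) {a : ℝ} (ha : 0 < a) {α : ℝ} (hα : 0 ≤ α) (hαw : ν * ((n : ℝ) - 1) * α ≤ 1 / w)
    (hplaqW : ∀ (y : Y) (v : Off ν n) (κ μ : Fin ν) (hκ : (v κ : ℕ) + 1 < n) (hμ : (v μ : ℕ) + 1 < n), κ ≠ μ →
      ‖cpxHom (plaqW W y v κ μ hκ hμ) - 1‖ ≤ α) (B : Y × Cp → ℂ) :
    (1 / 4 : ℝ) ^ ν / (a + 256 * ν) * ((n : ℝ) ^ 2 / (n : ℝ) ^ ν) * nsq B ≤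
      (star B ⬝ᵥ (sandwich (gramForm (a / (n : ℝ) ^ 2) (covDiff bsrc (btgt σ) W)) (covFamily sB (Rfam W hW)) *ᵥ B)).re := by
  have hn4 : (4 : ℝ) * w ≤ n := by exact_mod_cast h4
  have hn8 : (n : ℝ) ≤ 8 * w := by exact_mod_cast h8
  have hw' : (0 : ℝ) < w := by exact_mod_cast hw
  have hn : (0 : ℝ) < n := by linarith
  have h2w : 2 * w < n := by omega
  have hμ0 : 0 < a / (n : ℝ) ^ 2 := by positivity
  have hmain := coarse_coercive_plateau_blocks W hW σ hw h2w hμ0 hα hplaqW B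
  refine le_trans (mul_le_mul_of_nonneg_right ?_ (nsq_nonneg B)) hmain
  set H := ν * ((n : ℝ) - 1) * α with hH
  set s := 1 / (w : ℝ) + H with hs
  have hw1 : (1 : ℝ) ≤ w := by exact_mod_cast hw
  have hH0 : 0 ≤ H := by
    have : 0 ≤ (n : ℝ) - 1 := by linarith
    positivity
  have hs0 : 0 ≤ s := by positivity
  have hs16 : s ≤ 16 / n := by
    have h1 : 1 / (w : ℝ) ≤ 8 / n := by
      rw [div_le_div_iff₀ hw' hn]; linarith
    calc s ≤ 1 / w + 1 / w := by rw [hs]; gcongr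
      _ ≤ 8 / n + 8 / n := add_le_add h1 h1
      _ = 16 / n := by ring
  have hδ : (1 / 4 : ℝ) ^ ν ≤ ((((n : ℝ) - 2 * w) / n) ^ ν) ^ 2 := by
    have hhalf : (1 / 2 : ℝ) ≤ ((n : ℝ) - 2 * w) / n := by
      rw [le_div_iff₀ hn]; linarith
    have h0 : (0 : ℝ) ≤ 1 / 2 := by norm_num
    calc (1 / 4 : ℝ) ^ ν = ((1 / 2 : ℝ) ^ ν) ^ 2 := by rw [← pow_mul, mul_comm, pow_mul]; norm_num
      _ ≤ ((((n : ℝ) - 2 * w) / n) ^ ν) ^ 2 := by gcongr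
  have hE : a / (n : ℝ) ^ 2 * (1 * (n : ℝ) ^ ν) + s * (ν * (n : ℝ) ^ ν * s) ≤ (a + 256 * ν) * ((n : ℝ) ^ ν / (n : ℝ) ^ 2) := by
    have h2 : s ^ 2 ≤ (16 / n) ^ 2 := pow_le_pow_left₀ hs0 hs16 2
    have h3 : (ν : ℝ) * (n : ℝ) ^ ν * s ^ 2 ≤ ν * (n : ℝ) ^ ν * (16 / n) ^ 2 := by gcongr
    calc a / (n : ℝ) ^ 2 * (1 * (n : ℝ) ^ ν) + s * (ν * (n : ℝ) ^ ν * s)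
        = a * ((n : ℝ) ^ ν / (n : ℝ) ^ 2) + ν * (n : ℝ) ^ ν * s ^ 2 := by ring
      _ ≤ a * ((n : ℝ) ^ ν / (n : ℝ) ^ 2) + ν * (n : ℝ) ^ ν * (16 / n) ^ 2 := by linarith
      _ = (a + 256 * ν) * ((n : ℝ) ^ ν / (n : ℝ) ^ 2) := by
          field_simp
          ring
  have hEpos : 0 < a / (n : ℝ) ^ 2 * (1 * (n : ℝ) ^ ν) + s * (ν * (n : ℝ) ^ ν * s) := by positivity
  have hC0 : (0 : ℝ) ≤ ((((n : ℝ) - 2 * w) / n) ^ ν) ^ 2 := sq_nonneg _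
  calc (1 / 4 : ℝ) ^ ν / (a + 256 * ν) * ((n : ℝ) ^ 2 / (n : ℝ) ^ ν)
      = (1 / 4 : ℝ) ^ ν / ((a + 256 * ν) * ((n : ℝ) ^ ν / (n : ℝ) ^ 2)) := by
        field_simp
    _ ≤ ((((n : ℝ) - 2 * w) / n) ^ ν) ^ 2 / (a / (n : ℝ) ^ 2 * (1 * (n : ℝ) ^ ν) + s * (ν * (n : ℝ) ^ ν * s)) :=
        div_le_div₀ hC0 hδ hEpos hE

/-! ## §5 Non-vacuity: one block of side 3 in one dimension, trivial fibre, flat transport -/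

/-- `ν = 1`, `n = 3`, `w = 1`, one block glued to itself, fibre `Unit`, `W ≡ 1`, `μ₀ = 1`: the END gives the explicit
positive coercivity constant `((3−2)/3)²/(1·3 + 1·(1·3·1)) = 1/54`. [folklore] -/
example (B : Unit × Unit → ℂ) :
    (1 / 54 : ℝ) * nsq B ≤
      (star B ⬝ᵥ (sandwich (gramForm 1 (covDiff bsrc (btgt (fun (_ : Fin 1) (_ : Unit) => ()))
          fun _ : Bond Unit 1 3 => (1 : Matrix Unit Unit ℝ)))
        (covFamily (sB (Y := Unit) (ν := 1) (n := 3)) (Rfam (fun _ : Bond Unit 1 3 => (1 : Matrix Unit Unit ℝ)) flat_orth))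
          *ᵥ B)).re := by
  have h := coarse_coercive_plateau_blocks_flat (Y := Unit) (Cp := Unit) (ν := 1) (n := 3) (w := 1) (μ0 := 1)
    (fun (_ : Fin 1) (_ : Unit) => ()) Nat.one_pos (by norm_num) one_pos B
  convert h using 2
  norm_num

end

end Summit.QuantumFields.BalabanUV.Beta.CovariantPlateauBlocksEnd
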